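import Literature.MathematicalPhysics.QuantumFieldTheory.Balaban1983to89.B2LargeField
import Literature.MathematicalPhysics.QuantumFieldTheory.Balaban1983to89.HiggsRescaling
import Literature.MathematicalPhysics.QuantumFieldTheory.Balaban1983to89.B1Ineq234LevelZero

/-!
# `Balaban1983to89.B2Eq28RegionsConcrete` — T. Bałaban, *(Higgs)₂,₃ quantum fields in a finite volume. II. An upper bound*,
Commun. Math. Phys. **86** (1982) 555–594 [Balaban1982Higgs2] p. 558, (2.7)–(2.8): **the small-field regions
`Λ₀ ⊃ Λ₁ ⊃ Λ₂ ⊃ …` CONSTRUCTED ON THE CONCRETE (Higgs)₂,₃ TORUS** `…HiggsLattice.Site P k` from the set of lattice points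
at which the fields are large, by instantiating r14's abstract construction `…B2LargeField.lambdaCompl`, with the printed
consequences PROVED: every `Λ_i` (and `Λ_iᶜ`) is a union of large blocks, the regions are nested, `Λ_j` is separated from
`Λ_iᶜ` (`i < j`) and from the large-field points by more than `r(ε)`, and *"all the fields are small on the set Λ₀ and on the
neighbourhood of Λ₀ of the additional thickness r(ε)"*

statement-level skeleton of published theorems with citation tags; proofs where landed; nothing here is a claim about the Yang–Mills mass gap

PDF held: `paper:balaban1982-cmp86-higgs23-ii` (journal page = PDF page + 554); p. 558 [PDF 4] READ AS AN IMAGE on the ×2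
render `run/shared/lean/pub/pub-balaban/b2b-balaban-ref1/pages/1982-cmp86-higgs23-II/1982-cmp86-higgs23-II-p004-x2.png`;
part I [Balaban1982Higgs1] p. 607 [PDF 5] (large blocks), p. 604 (1.3) (the distance).

CITATION HEADER (lean-in-tree rule).  lit-balaban typed skeleton (HOME `run/shared/lean/pub/lit-balaban/`), typer line
(concrete carriers), gen 8.  SKELETON rows served: **B2.Eq2.7** ((2.7)–(2.8) + def of r(ε), fold owner r02, second reader
r14; row of record = r14's ABSTRACT `B2LargeField.lambda0Compl/lambdaSuccCompl/lambdaCompl` over types `Blk`, `Bad` with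
distance functions as data, p239284) — this file is its CONCRETE INSTANCE on the model's torus; the region letters of rows
**B2.Eq2.44/B2.Eq2.55** (`Λ_i^{(k)}`: the same construction one level up, p. 567 *"with ε replaced by L^{k−1}ε and Λ₀ by
Λ₀^{(k−1)}"*) are the members `k ≥ 1` of the level-generic statements below.  NOTHING of record is restated or redefined:
the regions ARE `B2LargeField.lambdaCompl` at the dictionary below, the large blocks ARE the typer's
`HiggsRescaling.largeBlockOf/largeBlock/IsUnionOfLargeBlocks` (p. 607), the distance IS (1.3) `HiggsLattice.Site.tdist`
with r14's `B1Ineq234LevelZero.tdist_comm` and `dist(x, Λᶜ)` = r14's `B1Ineq234Concrete.distC`; the abstract separation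
lemmas `B2LargeField.lambdaCompl_far/lambdaCompl_far_bad/lambdaCompl_mono_of_le` are USED, not re-proved.  p15's §3 tower
`B2Eq324NestedRegions.Tower` takes *"Λ₅^{(k)} is a union of blocks"* as the hypothesis `isUnion`
(`blockOf x = blockOf x′ → (x ∈ Λ ↔ x′ ∈ Λ)`); `region_blockOf_congr` below delivers exactly that shape for the regions
constructed here (large blocks are unions of blocks: `largeBlockOf_eq_of_blockOf_eq`, with r14's `B1Ineq234Concrete.val_blockOf_all`).

THE SOURCE TEXT, p. 558 [PDF 4], verbatim.  *"We will use here the division of the lattice T₁ into large blocks described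
in the first part [1]. Let us define: Λ₀ᶜ is the sum of all large blocks of T₁ distant from one of the sets B(P_v), Q_v,
R_v, B(P_s), Q_s, R_s less than r(ε) = R(1 + log ε⁻¹)^r. The numbers r, R satisfy r > 1, R > R₀ (R₀ occurs in the
formulation of Proposition I.2.1). (2.7)  Next let us define a sequence of sets Λ₁, Λ₂, … by an induction: Λ_{i+1}ᶜ is the
sum of all large blocks of T₁ with distances from the set Λ_iᶜ less or equal r(ε). (2.8)  Of course all the fields are
small on the set Λ₀ and on the neighbourhood of Λ₀ of the additional thickness r(ε) also. … Let us denote by Λ^{(*,′)}_{−1}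
the set of the points (the bonds, the blocks) in T₁ distant from Λ₀ less than r(ε)."*  Part I p. 607 [PDF 5]: *"Further we
will use the partitions into large blocks besides the partitions into blocks described above. They are defined in the same
way, only L is replaced by ML"*; (1.3) p. 604: `|x − y| = max_μ min{|x_μ − y_μ|, 2L_μ − |x_μ − y_μ|}`.

DICTIONARY (print ↦ Lean).  `T₁` ↦ the torus `HiggsLattice.Site P k` of level `k` (the statements are level-generic;
`k = 0` is the first step, the step-`(k+1)` regions `Λ_i^{(k)}` of p. 567 live on `Site P k`); distances in LATTICE UNITS of
`T^{(k)}` (`Site.tdist`, (1.3)), so `r : ℝ` ↦ `r(ε)/η` with `η` the spacing (`= r(L^{k−1}ε)` on the unit lattice of the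
print); *"large blocks"* ↦ `HiggsRescaling.largeBlockOf x` (side `LM` lattice units), a large block being handled through
ANY of its sites (r14's abstract block type `Blk` is instantiated by `Site P k`, two sites of one large block giving the
same distances: `lbDist_congr`, `lbDist₂_congr_left/right`); *"the sets B(P_v), Q_v, R_v, B(P_s), Q_s, R_s"* ↦ the finite
set `bad` of the lattice POINTS they occupy (a block `B(y)`, `y ∈ P_v ∪ P_s ⊂ T′₁`, contributes its `L^d` points
`HiggsLattice.block y`; a bond of `Q_v ∪ Q_s` its two endpoints `PBond.src/tgt`; a point of `R_v ∪ R_s` itself: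
`badSites`), r14's `Bad` being instantiated by `Site P k`; *"distant from [a set] less than r(ε)"* for a large block ↦
`lbDist x z < r` for some point `z` of the set, `lbDist x z = min{|x′ − z| : x′ in the large block of x}`; *"with distances
from the set Λ_iᶜ less or equal r(ε)"* ↦ `lbDist₂ x y ≤ r` for some `y ∈ Λ_iᶜ`, `lbDist₂ x y = min{|x′ − y′| : x′, y′ in the
large blocks of x, y}`; `Λ_iᶜ` ↦ `regionCompl bad r i : Set (Site P k)` (`= B2LargeField.lambdaCompl lbDist lbDist₂ bad r i`,
definitionally), `Λ_i` ↦ the `Finset` `region bad r i`; *"the neighbourhood of Λ₀ of the additional thickness r(ε)"* /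
`Λ_{−1}` ↦ `near Λ r = {y : |x − y| < r for some x ∈ Λ}` at `Λ = region bad r 0`.

WHAT THIS FILE PROVES (0 sorry; standard axioms; definitions with bodies + theorems; no `Prop`-valued definition).
§1 large blocks: `mem_largeBlock`, `mem_largeBlock_self`, `largeBlockOf_val`, **`largeBlockOf_eq_of_blockOf_eq`** (a large block is a union of
   blocks: `blockOf x = blockOf x′ ⇒ largeBlockOf x = largeBlockOf x′`, every level), `isUnionOfLargeBlocks_iff`,
   `isUnionOfLargeBlocks_blockOf_congr` (⇒ p15's `isUnion` shape), `isUnionOfLargeBlocks_compl`.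
§2 the two distances `lbDist`, `lbDist₂` (minima of (1.3) over large blocks): `≤ |x − z|`, `≥ 0`, `lbDist₂ x x = 0`,
   invariance under the choice of the representing site.
§3 the regions: `regionCompl` (= r14's `lambdaCompl`, `rfl`), `region`, `mem_region`, unfoldings `mem_regionCompl_zero/succ`;
   **`region_isUnionOfLargeBlocks`** / `regionCompl_largeBlockOf_congr` (*"the sum of all large blocks"*),
   **`region_blockOf_congr`**; **`region_succ_subset`** / `region_antitone` (`Λ_{i+1} ⊆ Λ_i`, for `r ≥ 0`);
   **`sep_region`** (`x ∈ Λ_j`, `y ∉ Λ_i`, `i < j` ⇒ `r < |x − y|`), `sep_region_succ`, **`lt_distC_region`**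
   (`r < dist(x, Λ_iᶜ)` for `x ∈ Λ_{i+1}` when `Λ_i ≠ T`), **`sep_bad`** (`x ∈ Λ_j`, `z` bad ⇒ `r ≤ |x − z|`),
   `not_mem_region_of_bad` (bad points lie in every `Λ_jᶜ`, `r > 0`), `region_eq_univ_of_bad_empty` (no large fields ⇒
   `Λ_i = T`).
§4 the p. 558 sentence: `near`, `subset_near`, **`not_bad_of_mem_near_region_zero`** (*"all the fields are small on the set
   Λ₀ and on the neighbourhood of Λ₀ of the additional thickness r(ε)"*: no bad point lies within distance `< r` of `Λ₀`),
   `disjoint_near_region_zero_bad`.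
§5 the printed bad sets: `badSites Pv Ps Qv Qs Rv Rs` with the membership lemmas `block_subset_badSites_v/s`,
   `src_mem_badSites_v/s`, `tgt_mem_badSites_v/s`, `mem_badSites_of_mem_v/s`, and the p. 558 sentence read on them
   (`block_far_of_mem_Pv`, `bond_far_of_mem_Qv`, `site_far_of_mem_Rv`: a large-field block / bond / point is at distance
   `≥ r` from every point of every `Λ_j`).
§6 (v1.1, append-only; no v1 declaration changed) the complements read OUTWARD: `tdist_le_of_largeBlockOf_eq` (a large
   block has diameter `≤ LM − 1` in (1.3)), `exists_lbDist_eq`/`exists_lbDist₂_eq` (the minima are attained),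
   `exists_bad_near_of_mem_regionCompl_zero` (a point of `Λ₀ᶜ` is within `< r + (LM − 1)` of a large-field point),
   `exists_near_of_mem_regionCompl_succ` (a point of `Λ_{i+1}ᶜ` is within `≤ r + 2(LM − 1)` of `Λ_iᶜ`),
   **`exists_bad_near_of_mem_regionCompl`** (every point of `Λ_iᶜ` is within `< (i+1)r + (2i+1)(LM − 1)` of the large-field
   set — the thickness of the complements behind the volume counts (2.13)/(3.46)), `mem_region_of_far_from_bad`.
§7 (v1.2, append-only) the p. 566 level-`0` «admissibility» condition PROVED for the construction: `compl_region_zero_nonempty`,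
   `compl_region_eq_empty_of_forall_not_bad`, **`admissible_zero`** (`Λ₀ᶜ = ∅`, or a large-field point of `Λ₀ᶜ` is at distance
   `≥ r` from every point of `Λ₀`), `admissible_zero_distC` (the same through r14's `distC`).
§8 (v1.3, append-only) volumes: `ball`/`card_ball_le` (a ball of radius `n` of (1.3) has `≤ (2n+1)^d` points — first such
   count for the `HiggsLattice` torus), `compl_region_subset_biUnion_ball`, **`card_compl_region_le`** (`|Λ_iᶜ| ≤ |bad|·(2ρ_i + 1)^d`,
   `ρ_i = ⌊(i+1)r + (2i+1)(LM − 1)⌋` — the concrete form of (3.44) + (3.48)/(3.50)), `card_compl_region_zero_le`.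
HONEST SCOPE.  (a) WHICH points are bad (the characteristic functions (2.2)–(2.5) of the fields, the admissible/minimal
6-tuples of (2.9)) is NOT this file's business: `bad` (or the six sets fed to `badSites`) is data — r14's
`B2Eq29Resummation` is the (2.9) dictionary; the regions here are the deterministic geometry (2.7)–(2.8) downstream of it.
(b) Distances to a bond/block are read through the lattice points they occupy (the print does not define the distance from
a large block to a bond otherwise); distances between large blocks are minima over their points, so *"less or equal r(ε)"*
in (2.8) makes every large block belong to the `r(ε)`-neighbourhood of itself (`lbDist₂_self`), which is what makes the
complements increase (r14's `hself`).  (c) Level-generic but ONE level at a time: the multi-step nesting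
`B(Λ₅^{(k+1)}) ⊂ Λ₅^{(k)}` of Sect. 3 ((3.11)–(3.20), p15's `Tower.nested`) is a different statement and is not claimed.
(d) No field, no measure, no estimate: value = the printed region geometry made concrete and its separation properties —
the `hsep`/`sep…`/`isUnion`-type HYPOTHESES of the (2.25)/(2.36)–(2.40)/(2.47)/(2.109)/(3.22) files — available BY NAME on
the carrier; NOT summit progress.  Unit `lit-balaban-typer` gen 8 (literature-prover-lit-balaban-typer-g8-0); HOME/FILED.md
records the proposal.
-/

open scoped BigOperators

namespace Literature.MathematicalPhysics.QuantumFieldTheory.Balaban1983to89.B2Eq28RegionsConcrete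

open HiggsLattice HiggsRescaling B2LargeField
open B1Ineq234Concrete (distC distC_nonneg tdist_self val_blockOf_all)
open B1Ineq234LevelZero (tdist_comm)

variable {P : HiggsLattice.Params} {k : ℕ}

/-! ## §1 Large blocks (part I p. 607): membership, and «a large block is a union of blocks» -/

section LargeBlocks

/-- Membership in a large block: `x ∈ (large block z)` iff the large block of `x` is `z`. [cite: Balaban1982Higgs1, (1.17) p.606] -/
theorem mem_largeBlock {z : LargeBlock P k} {x : HiggsLattice.Site P k} : x ∈ largeBlock z ↔ largeBlockOf x = z := by
  simp [largeBlock]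

/-- Every site lies in its own large block. [cite: Balaban1982Higgs1, (1.17) p.606] -/
theorem mem_largeBlock_self (x : HiggsLattice.Site P k) : x ∈ largeBlock (largeBlockOf x) :=
  mem_largeBlock.mpr rfl

/-- The label of the LARGE block of `x` in direction `μ` is the integer quotient `x_μ / (LM)`, as a natural number.
[cite: Balaban1982Higgs1, (1.17) p.606] -/
theorem largeBlockOf_val (x : HiggsLattice.Site P k) (μ : Fin P.d) : ((largeBlockOf x) μ).val = (x μ).val / (P.L * P.M) := by
  unfold largeBlockOf
  rw [ZMod.val_natCast]
  apply Nat.mod_eq_of_lt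
  have hx : (x μ).val < P.sitesPerDir k μ := ZMod.val_lt (x μ)
  have hL : 0 < P.L := P.hL
  have hM : 0 < P.M := P.hM
  have hLM : 0 < P.L * P.M := Nat.mul_pos hL hM
  rw [Nat.div_lt_iff_lt_mul hLM]
  rcases Nat.lt_or_ge k P.K with hk | hk
  · have hpow : P.L ^ (P.K - k) = P.L * P.L ^ (P.K - k - 1) := by
      rw [← pow_succ']
      congr 1
      omega
    calc (x μ).val < P.sitesPerDir k μ := hx
      _ = 2 * (P.L ^ (P.K - k) * P.M * P.Lp μ) := rfl
      _ = 2 * (P.L ^ (P.K - k - 1) * P.Lp μ) * (P.L * P.M) := by rw [hpow]; ring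
  · have h1 : P.K - k = 0 := by omega
    have h2 : P.K - k - 1 = 0 := by omega
    calc (x μ).val < P.sitesPerDir k μ := hx
      _ = 2 * (P.L ^ (P.K - k) * P.M * P.Lp μ) := rfl
      _ = 2 * (1 * P.Lp μ) * (1 * P.M) := by rw [h1, pow_zero]; ring
      _ ≤ 2 * (P.L ^ (P.K - k - 1) * P.Lp μ) * (P.L * P.M) := by
          rw [h2, pow_zero]
          exact Nat.mul_le_mul_left _ (Nat.mul_le_mul_right _ hL)

/-- **A large block is a union of blocks** (p. 607: large blocks are *"defined in the same way, only L is replaced by ML"*,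
so `B(y) ⊂` one large block): two sites of the same block lie in the same large block, at every level.
[cite: Balaban1982Higgs1, (1.17) p.606] -/
theorem largeBlockOf_eq_of_blockOf_eq {x x' : HiggsLattice.Site P k} (h : HiggsLattice.blockOf x = HiggsLattice.blockOf x') : largeBlockOf x = largeBlockOf x' := by
  funext μ
  have hμ : ((HiggsLattice.blockOf x) μ).val = ((HiggsLattice.blockOf x') μ).val := by rw [h]
  rw [val_blockOf_all, val_blockOf_all] at hμ
  apply (ZMod.val_injective _)
  rw [largeBlockOf_val, largeBlockOf_val, ← Nat.div_div_eq_div_mul, ← Nat.div_div_eq_div_mul, hμ]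

/-- Unfolding of the typer's `IsUnionOfLargeBlocks` (p. 607 / Prop. I.2.1's *"sum of big blocks"*): membership in `Ω` depends
only on the large block. [cite: Balaban1982Higgs1, Prop 2.1 p.610] -/
theorem isUnionOfLargeBlocks_iff (Ω : Finset (HiggsLattice.Site P k)) :
    IsUnionOfLargeBlocks Ω ↔ ∀ x x' : HiggsLattice.Site P k, largeBlockOf x = largeBlockOf x' → (x ∈ Ω ↔ x' ∈ Ω) := by
  constructor
  · intro h x x' hxx'
    exact ⟨fun hx => h x hx x' hxx'.symm, fun hx' => h x' hx' x hxx'⟩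
  · intro h x hx x' hx'x
    exact (h x x' hx'x.symm).mp hx

/-- A union of large blocks is a union of blocks, in the shape of p15's `B2Eq324NestedRegions.Tower.isUnion`:
`blockOf x = HiggsLattice.blockOf x′ → (x ∈ Ω ↔ x′ ∈ Ω)`. [cite: Balaban1982Higgs2, (3.22) p.588] -/
theorem isUnionOfLargeBlocks_blockOf_congr {Ω : Finset (HiggsLattice.Site P k)} (h : IsUnionOfLargeBlocks Ω) {x x' : HiggsLattice.Site P k}
    (hb : HiggsLattice.blockOf x = HiggsLattice.blockOf x') : x ∈ Ω ↔ x' ∈ Ω :=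
  (isUnionOfLargeBlocks_iff Ω).mp h x x' (largeBlockOf_eq_of_blockOf_eq hb)

/-- The complement of a union of large blocks is a union of large blocks (p. 558: both `Λ_i` and `Λ_iᶜ` are *"sums of large
blocks"*). [cite: Balaban1982Higgs2, (2.8) p.558] -/
theorem isUnionOfLargeBlocks_compl {Ω : Finset (HiggsLattice.Site P k)} (h : IsUnionOfLargeBlocks Ω) : IsUnionOfLargeBlocks Ωᶜ := by
  rw [isUnionOfLargeBlocks_iff] at h ⊢
  intro x x' hxx'
  rw [Finset.mem_compl, Finset.mem_compl, h x x' hxx']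

end LargeBlocks

/-! ## §2 Distances from a large block to a point and between two large blocks (minima of (1.3)) -/

section Distances

/-- **`dist(large block of x, z)`** = `min{|x′ − z| : x′ in the large block of x}` in the distance (1.3), lattice units —
r14's `bdist` for (2.7). [cite: Balaban1982Higgs2, (2.7) p.558] -/
noncomputable def lbDist (x z : HiggsLattice.Site P k) : ℝ :=
  (largeBlock (largeBlockOf x)).inf' ⟨x, mem_largeBlock_self x⟩ fun x' => (HiggsLattice.Site.tdist x' z : ℝ)

/-- **`dist(large block of x, large block of y)`** = `min{|x′ − y′| : x′, y′ in the large blocks of x, y}` — r14's `ddist`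
for (2.8). [cite: Balaban1982Higgs2, (2.8) p.558] -/
noncomputable def lbDist₂ (x y : HiggsLattice.Site P k) : ℝ :=
  (largeBlock (largeBlockOf x) ×ˢ largeBlock (largeBlockOf y)).inf'
    ⟨(x, y), Finset.mk_mem_product (mem_largeBlock_self x) (mem_largeBlock_self y)⟩
    fun p => (HiggsLattice.Site.tdist p.1 p.2 : ℝ)

/-- `dist(block of x, z) ≤ |x′ − z|` for every `x′` in the large block of `x`. [cite: Balaban1982Higgs2, (2.7) p.558] -/
theorem lbDist_le_of_mem {x x' : HiggsLattice.Site P k} (hx' : largeBlockOf x' = largeBlockOf x) (z : HiggsLattice.Site P k) :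
    lbDist x z ≤ (HiggsLattice.Site.tdist x' z : ℝ) :=
  Finset.inf'_le (fun w => (HiggsLattice.Site.tdist w z : ℝ)) (mem_largeBlock.mpr hx')

/-- `dist(block of x, z) ≤ |x − z|`. [cite: Balaban1982Higgs2, (2.7) p.558] -/
theorem lbDist_le_tdist (x z : HiggsLattice.Site P k) : lbDist x z ≤ (HiggsLattice.Site.tdist x z : ℝ) :=
  lbDist_le_of_mem rfl z

/-- Lower bounds of `dist(block of x, z)`: `c ≤ dist` iff `c ≤ |x′ − z|` for all `x′` in the large block of `x`.
[cite: Balaban1982Higgs2, (2.7) p.558] -/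
theorem le_lbDist_iff {c : ℝ} {x z : HiggsLattice.Site P k} :
    c ≤ lbDist x z ↔ ∀ x' : HiggsLattice.Site P k, largeBlockOf x' = largeBlockOf x → c ≤ (HiggsLattice.Site.tdist x' z : ℝ) := by
  unfold lbDist
  rw [Finset.le_inf'_iff]
  simp only [mem_largeBlock]

/-- `dist(block of x, z) ≥ 0`. [cite: Balaban1982Higgs2, (2.7) p.558] -/
theorem lbDist_nonneg (x z : HiggsLattice.Site P k) : 0 ≤ lbDist x z :=
  le_lbDist_iff.mpr fun _ _ => Nat.cast_nonneg _

/-- The distance from a large block does not depend on the site representing it. [cite: Balaban1982Higgs2, (2.7) p.558] -/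
theorem lbDist_congr {x x' : HiggsLattice.Site P k} (h : largeBlockOf x = largeBlockOf x') (z : HiggsLattice.Site P k) : lbDist x z = lbDist x' z := by
  apply le_antisymm
  · exact le_lbDist_iff.mpr fun w hw => lbDist_le_of_mem (hw.trans h.symm) z
  · exact le_lbDist_iff.mpr fun w hw => lbDist_le_of_mem (hw.trans h) z

/-- `dist(block of x, block of y) ≤ |x′ − y′|` for all representatives. [cite: Balaban1982Higgs2, (2.8) p.558] -/
theorem lbDist₂_le_of_mem {x x' y y' : HiggsLattice.Site P k} (hx' : largeBlockOf x' = largeBlockOf x)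
    (hy' : largeBlockOf y' = largeBlockOf y) : lbDist₂ x y ≤ (HiggsLattice.Site.tdist x' y' : ℝ) :=
  Finset.inf'_le (fun p : HiggsLattice.Site P k × HiggsLattice.Site P k => (HiggsLattice.Site.tdist p.1 p.2 : ℝ))
    (Finset.mk_mem_product (mem_largeBlock.mpr hx') (mem_largeBlock.mpr hy'))

/-- `dist(block of x, block of y) ≤ |x − y|`. [cite: Balaban1982Higgs2, (2.8) p.558] -/
theorem lbDist₂_le_tdist (x y : HiggsLattice.Site P k) : lbDist₂ x y ≤ (HiggsLattice.Site.tdist x y : ℝ) :=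
  lbDist₂_le_of_mem rfl rfl

/-- Lower bounds of `dist(block of x, block of y)`. [cite: Balaban1982Higgs2, (2.8) p.558] -/
theorem le_lbDist₂_iff {c : ℝ} {x y : HiggsLattice.Site P k} :
    c ≤ lbDist₂ x y ↔ ∀ x' y' : HiggsLattice.Site P k, largeBlockOf x' = largeBlockOf x → largeBlockOf y' = largeBlockOf y →
      c ≤ (HiggsLattice.Site.tdist x' y' : ℝ) := by
  unfold lbDist₂
  rw [Finset.le_inf'_iff]
  simp only [Finset.mem_product, mem_largeBlock, and_imp, Prod.forall]

/-- `dist(block of x, block of y) ≥ 0`. [cite: Balaban1982Higgs2, (2.8) p.558] -/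
theorem lbDist₂_nonneg (x y : HiggsLattice.Site P k) : 0 ≤ lbDist₂ x y :=
  le_lbDist₂_iff.mpr fun _ _ _ _ => Nat.cast_nonneg _

/-- A large block is at distance `0` from itself (so *"less or equal r(ε)"* in (2.8) puts every block of `Λ_iᶜ` into `Λ_{i+1}ᶜ`).
[cite: Balaban1982Higgs2, (2.8) p.558] -/
theorem lbDist₂_self (x : HiggsLattice.Site P k) : lbDist₂ x x = 0 :=
  le_antisymm ((lbDist₂_le_tdist x x).trans (by rw [tdist_self]; simp)) (lbDist₂_nonneg x x)

/-- Invariance of `lbDist₂` in the first block representative. [cite: Balaban1982Higgs2, (2.8) p.558] -/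
theorem lbDist₂_congr_left {x x' : HiggsLattice.Site P k} (h : largeBlockOf x = largeBlockOf x') (y : HiggsLattice.Site P k) :
    lbDist₂ x y = lbDist₂ x' y := by
  apply le_antisymm
  · exact le_lbDist₂_iff.mpr fun w v hw hv => lbDist₂_le_of_mem (hw.trans h.symm) hv
  · exact le_lbDist₂_iff.mpr fun w v hw hv => lbDist₂_le_of_mem (hw.trans h) hv

/-- Invariance of `lbDist₂` in the second block representative. [cite: Balaban1982Higgs2, (2.8) p.558] -/
theorem lbDist₂_congr_right (x : HiggsLattice.Site P k) {y y' : HiggsLattice.Site P k} (h : largeBlockOf y = largeBlockOf y') :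
    lbDist₂ x y = lbDist₂ x y' := by
  apply le_antisymm
  · exact le_lbDist₂_iff.mpr fun w v hw hv => lbDist₂_le_of_mem hw (hv.trans h.symm)
  · exact le_lbDist₂_iff.mpr fun w v hw hv => lbDist₂_le_of_mem hw (hv.trans h)

end Distances

/-! ## §3 The regions (2.7)–(2.8) on the torus: r14's `lambdaCompl` at the concrete distances -/

section Regions

/-- **`Λ_iᶜ` of (2.7)–(2.8) on `T^{(k)}`**, as a set of SITES: r14's `B2LargeField.lambdaCompl` with blocks represented by
their sites, `bdist = lbDist`, `ddist = lbDist₂`, the large-field data `bad` = the lattice points of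
`B(P_v) ∪ Q_v ∪ R_v ∪ B(P_s) ∪ Q_s ∪ R_s`, threshold `r` (↤ `r(ε)` in lattice units). [cite: Balaban1982Higgs2, (2.7)–(2.8) p.558] -/
def regionCompl (bad : Set (HiggsLattice.Site P k)) (r : ℝ) (i : ℕ) : Set (HiggsLattice.Site P k) :=
  lambdaCompl lbDist lbDist₂ bad r i

/-- **`Λ_i` of (2.7)–(2.8) on `T^{(k)}`**, as a finite set of sites (the complement of `regionCompl`).
[cite: Balaban1982Higgs2, (2.7)–(2.8) p.558] -/
noncomputable def region (bad : Set (HiggsLattice.Site P k)) (r : ℝ) (i : ℕ) : Finset (HiggsLattice.Site P k) :=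
  open Classical in Finset.univ.filter fun x => x ∉ regionCompl bad r i

variable {bad : Set (HiggsLattice.Site P k)} {r : ℝ}

/-- `x ∈ Λ_i ↔ x ∉ Λ_iᶜ`. [cite: Balaban1982Higgs2, (2.7)–(2.8) p.558] -/
theorem mem_region {i : ℕ} {x : HiggsLattice.Site P k} : x ∈ region bad r i ↔ x ∉ regionCompl bad r i := by
  unfold region
  simp only [Finset.mem_filter, Finset.mem_univ, true_and]

/-- `x ∉ Λ_i ↔ x ∈ Λ_iᶜ`. [cite: Balaban1982Higgs2, (2.7)–(2.8) p.558] -/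
theorem not_mem_region {i : ℕ} {x : HiggsLattice.Site P k} : x ∉ region bad r i ↔ x ∈ regionCompl bad r i := by
  rw [mem_region, not_not]

/-- The `Finset` complement of `Λ_i` is `Λ_iᶜ`. [cite: Balaban1982Higgs2, (2.7)–(2.8) p.558] -/
theorem mem_compl_region {i : ℕ} {x : HiggsLattice.Site P k} : x ∈ (region bad r i)ᶜ ↔ x ∈ regionCompl bad r i := by
  rw [Finset.mem_compl, not_mem_region]

/-- **(2.7) unfolded**: `x ∈ Λ₀ᶜ` iff the large block of `x` is at distance `< r` from some large-field point.
[cite: Balaban1982Higgs2, (2.7) p.558] -/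
theorem mem_regionCompl_zero {x : HiggsLattice.Site P k} : x ∈ regionCompl bad r 0 ↔ ∃ z ∈ bad, lbDist x z < r := Iff.rfl

/-- **(2.8) unfolded**: `x ∈ Λ_{i+1}ᶜ` iff the large block of `x` is at distance `≤ r` from (the large block of) some point of
`Λ_iᶜ`. [cite: Balaban1982Higgs2, (2.8) p.558] -/
theorem mem_regionCompl_succ {i : ℕ} {x : HiggsLattice.Site P k} :
    x ∈ regionCompl bad r (i + 1) ↔ ∃ y ∈ regionCompl bad r i, lbDist₂ x y ≤ r := Iff.rfl

/-- `Λ_iᶜ` IS r14's abstract `lambdaCompl` at the concrete dictionary (definitional). [cite: Balaban1982Higgs2, (2.7)–(2.8) p.558] -/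
theorem regionCompl_eq_lambdaCompl (bad : Set (HiggsLattice.Site P k)) (r : ℝ) (i : ℕ) :
    regionCompl bad r i = lambdaCompl lbDist lbDist₂ bad r i := rfl

/-- **`Λ_iᶜ` is a sum of large blocks** ((2.7): *"Λ₀ᶜ is the sum of all large blocks …"*, (2.8): *"Λ_{i+1}ᶜ is the sum of all
large blocks …"*): membership depends only on the large block. [cite: Balaban1982Higgs2, (2.7)–(2.8) p.558] -/
theorem regionCompl_largeBlockOf_congr {x x' : HiggsLattice.Site P k} (h : largeBlockOf x = largeBlockOf x') :
    ∀ i : ℕ, x ∈ regionCompl bad r i ↔ x' ∈ regionCompl bad r i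
  | 0 => by
      rw [mem_regionCompl_zero, mem_regionCompl_zero]
      simp_rw [lbDist_congr h]
  | i + 1 => by
      rw [mem_regionCompl_succ, mem_regionCompl_succ]
      simp_rw [lbDist₂_congr_left h]

/-- **`Λ_i` is a sum of large blocks** (the typer's `HiggsRescaling.IsUnionOfLargeBlocks`, p. 607 / the *"sum of big blocks"*
hypothesis shape of Prop. I.2.1). [cite: Balaban1982Higgs2, (2.8) p.558] -/
theorem region_isUnionOfLargeBlocks (bad : Set (HiggsLattice.Site P k)) (r : ℝ) (i : ℕ) : IsUnionOfLargeBlocks (region bad r i) := by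
  rw [isUnionOfLargeBlocks_iff]
  intro x x' h
  rw [mem_region, mem_region, regionCompl_largeBlockOf_congr h i]

/-- `Λ_iᶜ` (as a `Finset`) is a sum of large blocks. [cite: Balaban1982Higgs2, (2.8) p.558] -/
theorem compl_region_isUnionOfLargeBlocks (bad : Set (HiggsLattice.Site P k)) (r : ℝ) (i : ℕ) :
    IsUnionOfLargeBlocks (region bad r i)ᶜ :=
  isUnionOfLargeBlocks_compl (region_isUnionOfLargeBlocks bad r i)

/-- **`Λ_i` is a union of blocks**, in the shape of p15's `B2Eq324NestedRegions.Tower.isUnion`.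
[cite: Balaban1982Higgs2, (3.22) p.588] -/
theorem region_blockOf_congr (bad : Set (HiggsLattice.Site P k)) (r : ℝ) (i : ℕ) {x x' : HiggsLattice.Site P k} (hb : HiggsLattice.blockOf x = HiggsLattice.blockOf x') :
    x ∈ region bad r i ↔ x' ∈ region bad r i :=
  isUnionOfLargeBlocks_blockOf_congr (region_isUnionOfLargeBlocks bad r i) hb

/-- **The regions are nested, `Λ_{i+1} ⊆ Λ_i`** (`r ≥ 0`: every large block of `Λ_iᶜ` is at distance `0 ≤ r` from itself, so
`Λ_iᶜ ⊆ Λ_{i+1}ᶜ` — r14's `lambdaCompl_mono`). [cite: Balaban1982Higgs2, (2.8) p.558] -/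
theorem region_succ_subset (hr : 0 ≤ r) (i : ℕ) : region bad r (i + 1) ⊆ region bad r i := by
  intro x hx
  rw [mem_region] at hx ⊢
  exact fun h => hx (lambdaCompl_mono lbDist lbDist₂ bad (fun y => by rw [lbDist₂_self]; exact hr) i h)

/-- `Λ_j ⊆ Λ_i` for `i ≤ j`. [cite: Balaban1982Higgs2, (2.8) p.558] -/
theorem region_antitone (hr : 0 ≤ r) {i j : ℕ} (hij : i ≤ j) : region bad r j ⊆ region bad r i := by
  intro x hx
  rw [mem_region] at hx ⊢
  exact fun h => hx (lambdaCompl_mono_of_le lbDist lbDist₂ bad (fun y => by rw [lbDist₂_self]; exact hr) hij h)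

/-- **(2.8), the separation, AT SITE LEVEL**: a point of `Λ_j` and a point outside `Λ_i`, `i < j`, are at distance `> r`
(r14's block-level `lambdaCompl_far` + `dist(blocks) ≤ |x − y|`). [cite: Balaban1982Higgs2, (2.8) p.558] -/
theorem sep_region (hr : 0 ≤ r) {i j : ℕ} (hij : i < j) {x y : HiggsLattice.Site P k} (hx : x ∈ region bad r j)
    (hy : y ∉ region bad r i) : r < (HiggsLattice.Site.tdist x y : ℝ) := by
  rw [mem_region] at hx
  rw [not_mem_region] at hy
  exact (lambdaCompl_far (fun w => by rw [lbDist₂_self]; exact hr) hij hx hy).trans_le (lbDist₂_le_tdist x y)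

/-- The one-step case: `x ∈ Λ_{i+1}`, `y ∉ Λ_i` ⇒ `r < |x − y|`. [cite: Balaban1982Higgs2, (2.8) p.558] -/
theorem sep_region_succ (hr : 0 ≤ r) (i : ℕ) {x y : HiggsLattice.Site P k} (hx : x ∈ region bad r (i + 1))
    (hy : y ∉ region bad r i) : r < (HiggsLattice.Site.tdist x y : ℝ) :=
  sep_region hr (Nat.lt_succ_self i) hx hy

/-- The separation is symmetric in the two points (`|x − y| = |y − x|`, r14's `tdist_comm`). [cite: Balaban1982Higgs2, (2.8) p.558] -/
theorem sep_region' (hr : 0 ≤ r) {i j : ℕ} (hij : i < j) {x y : HiggsLattice.Site P k} (hx : x ∈ region bad r j)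
    (hy : y ∉ region bad r i) : r < (HiggsLattice.Site.tdist y x : ℝ) := by
  rw [tdist_comm]
  exact sep_region hr hij hx hy

/-- **`dist(x, Λ_iᶜ) > r` on `Λ_{i+1}`** (the boundary weight `dist(·, Λᶜ)` of (I.2.36) = r14's `B1Ineq234Concrete.distC`;
when `Λ_i` is the whole torus there is no complement and `distC = 0` by convention, whence the non-emptiness guard).
[cite: Balaban1982Higgs2, (2.8) p.558] -/
theorem lt_distC_region (hr : 0 ≤ r) (i : ℕ) {x : HiggsLattice.Site P k} (hx : x ∈ region bad r (i + 1))
    (hne : ((region bad r i)ᶜ).Nonempty) : r < distC (region bad r i) x := by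
  unfold distC
  rw [dif_pos hne, Finset.lt_inf'_iff]
  intro y hy
  exact sep_region_succ hr i hx (Finset.mem_compl.mp hy)

/-- More generally `dist(x, Λ_iᶜ) > r` on `Λ_j`, `i < j`. [cite: Balaban1982Higgs2, (2.8) p.558] -/
theorem lt_distC_region_of_lt (hr : 0 ≤ r) {i j : ℕ} (hij : i < j) {x : HiggsLattice.Site P k} (hx : x ∈ region bad r j)
    (hne : ((region bad r i)ᶜ).Nonempty) : r < distC (region bad r i) x := by
  unfold distC
  rw [dif_pos hne, Finset.lt_inf'_iff]
  intro y hy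
  exact sep_region hr hij hx (Finset.mem_compl.mp hy)

/-- **(2.7), the separation from the large fields, AT SITE LEVEL**: a point of any `Λ_j` is at distance `≥ r` from every
large-field point (r14's `lambdaCompl_far_bad` + `dist(block, z) ≤ |x − z|`). [cite: Balaban1982Higgs2, (2.7) p.558] -/
theorem sep_bad (hr : 0 ≤ r) (j : ℕ) {x z : HiggsLattice.Site P k} (hx : x ∈ region bad r j) (hz : z ∈ bad) :
    r ≤ (HiggsLattice.Site.tdist x z : ℝ) := by
  rw [mem_region] at hx
  exact (lambdaCompl_far_bad (fun w => by rw [lbDist₂_self]; exact hr) j hx hz).trans (lbDist_le_tdist x z)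

/-- Symmetric form of `sep_bad`. [cite: Balaban1982Higgs2, (2.7) p.558] -/
theorem sep_bad' (hr : 0 ≤ r) (j : ℕ) {x z : HiggsLattice.Site P k} (hx : x ∈ region bad r j) (hz : z ∈ bad) :
    r ≤ (HiggsLattice.Site.tdist z x : ℝ) := by
  rw [tdist_comm]
  exact sep_bad hr j hx hz

/-- The large-field points themselves lie in `Λ₀ᶜ` (their own large block is at distance `0 < r`), hence outside every `Λ_j`.
[cite: Balaban1982Higgs2, (2.7) p.558] -/
theorem not_mem_region_of_bad (hr : 0 < r) (j : ℕ) {z : HiggsLattice.Site P k} (hz : z ∈ bad) : z ∉ region bad r j := by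
  intro h
  have := sep_bad hr.le j h hz
  rw [tdist_self, Nat.cast_zero] at this
  exact absurd this (not_le.mpr hr)

/-- With no large fields at all, every `Λ_i` is the whole torus. [cite: Balaban1982Higgs2, (2.7)–(2.8) p.558] -/
theorem region_eq_univ_of_bad_empty (r : ℝ) : ∀ i : ℕ, region (∅ : Set (HiggsLattice.Site P k)) r i = Finset.univ
  | 0 => by
      ext x
      simp only [Finset.mem_univ, mem_region, mem_regionCompl_zero, Set.mem_empty_iff_false, false_and,
        exists_false, not_false_eq_true]
  | i + 1 => by
      ext x
      simp only [Finset.mem_univ, iff_true, mem_region, mem_regionCompl_succ, not_exists, not_and]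
      intro y hy
      have : y ∈ region (∅ : Set (HiggsLattice.Site P k)) r i := by rw [region_eq_univ_of_bad_empty r i]; exact Finset.mem_univ y
      exact absurd hy (mem_region.mp this)

end Regions

/-! ## §4 *"all the fields are small on the set Λ₀ and on the neighbourhood of Λ₀ of the additional thickness r(ε)"* -/

section Neighbourhood

/-- The `r`-neighbourhood of a set of sites: the points at distance `< r` from it (p. 558: *"the set of the points … in T₁
distant from Λ₀ less than r(ε)"*, the point part of `Λ_{−1}`). [cite: Balaban1982Higgs2, (2.9) p.558] -/
noncomputable def near (Λ : Finset (HiggsLattice.Site P k)) (r : ℝ) : Finset (HiggsLattice.Site P k) :=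
  Finset.univ.filter fun y => ∃ x ∈ Λ, (HiggsLattice.Site.tdist x y : ℝ) < r

variable {bad : Set (HiggsLattice.Site P k)} {r : ℝ}

/-- Membership in the neighbourhood. [cite: Balaban1982Higgs2, (2.9) p.558] -/
theorem mem_near {Λ : Finset (HiggsLattice.Site P k)} {y : HiggsLattice.Site P k} : y ∈ near Λ r ↔ ∃ x ∈ Λ, (HiggsLattice.Site.tdist x y : ℝ) < r := by
  unfold near
  simp only [Finset.mem_filter, Finset.mem_univ, true_and]

/-- A set lies in its own `r`-neighbourhood (`r > 0`). [cite: Balaban1982Higgs2, (2.9) p.558] -/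
theorem subset_near {Λ : Finset (HiggsLattice.Site P k)} (hr : 0 < r) : Λ ⊆ near Λ r := fun x hx =>
  mem_near.mpr ⟨x, hx, by rw [tdist_self, Nat.cast_zero]; exact hr⟩

/-- The neighbourhood is monotone in the set. [cite: Balaban1982Higgs2, (2.9) p.558] -/
theorem near_mono {Λ Λ' : Finset (HiggsLattice.Site P k)} (h : Λ ⊆ Λ') : near Λ r ⊆ near Λ' r := fun y hy => by
  obtain ⟨x, hx, hxy⟩ := mem_near.mp hy
  exact mem_near.mpr ⟨x, h hx, hxy⟩

/-- **p. 558: «all the fields are small on the set Λ₀ and on the neighbourhood of Λ₀ of the additional thickness r(ε)»** —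
no large-field point lies within distance `< r` of `Λ₀` (if `z` is bad and `|x − z| < r` then the large block of `x` is at
distance `< r` from `z`, i.e. `x ∈ Λ₀ᶜ` by (2.7)). [cite: Balaban1982Higgs2, (2.8) p.558] -/
theorem not_bad_of_mem_near_region_zero (hr : 0 ≤ r) {y : HiggsLattice.Site P k} (hy : y ∈ near (region bad r 0) r) : y ∉ bad := by
  intro hbad
  obtain ⟨x, hx, hxy⟩ := mem_near.mp hy
  exact absurd (sep_bad hr 0 hx hbad) (not_le.mpr hxy)

/-- The same for every `Λ_j ⊆ Λ₀`: no large-field point within distance `< r` of `Λ_j`. [cite: Balaban1982Higgs2, (2.8) p.558] -/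
theorem not_bad_of_mem_near_region (hr : 0 ≤ r) (j : ℕ) {y : HiggsLattice.Site P k} (hy : y ∈ near (region bad r j) r) : y ∉ bad :=
  not_bad_of_mem_near_region_zero hr (near_mono (region_antitone hr (Nat.zero_le j)) hy)

/-- `Λ_{−1} ∩ (large-field points) = ∅`, as a disjointness of finite sets. [cite: Balaban1982Higgs2, (2.8) p.558] -/
theorem disjoint_near_region_zero_bad (hr : 0 ≤ r) (badF : Finset (HiggsLattice.Site P k)) :
    Disjoint (near (region (↑badF : Set (HiggsLattice.Site P k)) r 0) r) badF := by
  rw [Finset.disjoint_left]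
  intro y hy hbad
  exact not_bad_of_mem_near_region_zero hr hy (Finset.mem_coe.mpr hbad)

end Neighbourhood

/-! ## §5 The printed large-field data: the points of `B(P_v) ∪ Q_v ∪ R_v ∪ B(P_s) ∪ Q_s ∪ R_s` -/

section BadSites

/-- **The lattice points occupied by the six large-field sets of (2.6)–(2.7)**: the blocks `B(y)`, `y ∈ P_v ∪ P_s ⊂ T′`
(`HiggsLattice.blockSet`), the endpoints of the bonds of `Q_v ∪ Q_s`, and the points `R_v ∪ R_s`.
[cite: Balaban1982Higgs2, (2.7) p.558] -/
noncomputable def badSites (Pv Ps : Finset (HiggsLattice.Site P (k + 1))) (Qv Qs : Finset (HiggsLattice.PBond P k)) (Rv Rs : Finset (HiggsLattice.Site P k)) :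
    Finset (HiggsLattice.Site P k) :=
  HiggsLattice.blockSet Pv ∪ HiggsLattice.blockSet Ps ∪ (Qv.image HiggsLattice.PBond.src ∪ Qv.image HiggsLattice.PBond.tgt) ∪ (Qs.image HiggsLattice.PBond.src ∪ Qs.image HiggsLattice.PBond.tgt)
    ∪ Rv ∪ Rs

variable (Pv Ps : Finset (HiggsLattice.Site P (k + 1))) (Qv Qs : Finset (HiggsLattice.PBond P k)) (Rv Rs : Finset (HiggsLattice.Site P k))

/-- The points of a block of `P_v` are bad. [cite: Balaban1982Higgs2, (2.7) p.558] -/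
theorem mem_badSites_of_blockOf_mem_v {x : HiggsLattice.Site P k} (hx : HiggsLattice.blockOf x ∈ Pv) : x ∈ badSites Pv Ps Qv Qs Rv Rs := by
  unfold badSites
  have : x ∈ HiggsLattice.blockSet Pv := (HiggsLattice.mem_blockSet Pv x).mpr hx
  simp only [Finset.mem_union, this, true_or]

/-- The points of a block of `P_s` are bad. [cite: Balaban1982Higgs2, (2.7) p.558] -/
theorem mem_badSites_of_blockOf_mem_s {x : HiggsLattice.Site P k} (hx : HiggsLattice.blockOf x ∈ Ps) : x ∈ badSites Pv Ps Qv Qs Rv Rs := by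
  unfold badSites
  have : x ∈ HiggsLattice.blockSet Ps := (HiggsLattice.mem_blockSet Ps x).mpr hx
  simp only [Finset.mem_union, this, true_or, or_true]

/-- The initial point of a bond of `Q_v` is bad. [cite: Balaban1982Higgs2, (2.7) p.558] -/
theorem src_mem_badSites_v {b : HiggsLattice.PBond P k} (hb : b ∈ Qv) : b.src ∈ badSites Pv Ps Qv Qs Rv Rs := by
  unfold badSites
  have : b.src ∈ Qv.image HiggsLattice.PBond.src := Finset.mem_image_of_mem _ hb
  simp only [Finset.mem_union, this, true_or, or_true]

/-- The final point of a bond of `Q_v` is bad. [cite: Balaban1982Higgs2, (2.7) p.558] -/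
theorem tgt_mem_badSites_v {b : HiggsLattice.PBond P k} (hb : b ∈ Qv) : b.tgt ∈ badSites Pv Ps Qv Qs Rv Rs := by
  unfold badSites
  have : b.tgt ∈ Qv.image HiggsLattice.PBond.tgt := Finset.mem_image_of_mem _ hb
  simp only [Finset.mem_union, this, true_or, or_true]

/-- The initial point of a bond of `Q_s` is bad. [cite: Balaban1982Higgs2, (2.7) p.558] -/
theorem src_mem_badSites_s {b : HiggsLattice.PBond P k} (hb : b ∈ Qs) : b.src ∈ badSites Pv Ps Qv Qs Rv Rs := by
  unfold badSites
  have : b.src ∈ Qs.image HiggsLattice.PBond.src := Finset.mem_image_of_mem _ hb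
  simp only [Finset.mem_union, this, true_or, or_true]

/-- The final point of a bond of `Q_s` is bad. [cite: Balaban1982Higgs2, (2.7) p.558] -/
theorem tgt_mem_badSites_s {b : HiggsLattice.PBond P k} (hb : b ∈ Qs) : b.tgt ∈ badSites Pv Ps Qv Qs Rv Rs := by
  unfold badSites
  have : b.tgt ∈ Qs.image HiggsLattice.PBond.tgt := Finset.mem_image_of_mem _ hb
  simp only [Finset.mem_union, this, true_or, or_true]

/-- The points of `R_v` are bad. [cite: Balaban1982Higgs2, (2.7) p.558] -/
theorem mem_badSites_of_mem_v {x : HiggsLattice.Site P k} (hx : x ∈ Rv) : x ∈ badSites Pv Ps Qv Qs Rv Rs := by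
  unfold badSites
  simp only [Finset.mem_union, hx, true_or, or_true]

/-- The points of `R_s` are bad. [cite: Balaban1982Higgs2, (2.7) p.558] -/
theorem mem_badSites_of_mem_s {x : HiggsLattice.Site P k} (hx : x ∈ Rs) : x ∈ badSites Pv Ps Qv Qs Rv Rs := by
  unfold badSites
  simp only [Finset.mem_union, hx, or_true]

/-- **The regions of (2.7)–(2.8) for the printed data**: `Λ_i(P_v, P_s, Q_v, Q_s, R_v, R_s; r)`.
[cite: Balaban1982Higgs2, (2.7)–(2.8) p.558] -/
noncomputable def regionOf (r : ℝ) (i : ℕ) : Finset (HiggsLattice.Site P k) :=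
  region (↑(badSites Pv Ps Qv Qs Rv Rs) : Set (HiggsLattice.Site P k)) r i

/-- `regionOf` unfolds to `region` at `badSites`. [cite: Balaban1982Higgs2, (2.7)–(2.8) p.558] -/
theorem regionOf_eq (r : ℝ) (i : ℕ) :
    regionOf Pv Ps Qv Qs Rv Rs r i = region (↑(badSites Pv Ps Qv Qs Rv Rs) : Set (HiggsLattice.Site P k)) r i := rfl

variable {Pv Ps Qv Qs Rv Rs} {r : ℝ}

/-- p. 558 for the blocks of `P_v`: every point of a large-field block `B(y)`, `y ∈ P_v`, is at distance `≥ r` from every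
point of every `Λ_j`. [cite: Balaban1982Higgs2, (2.7) p.558] -/
theorem block_far_of_mem_Pv (hr : 0 ≤ r) (j : ℕ) {x z : HiggsLattice.Site P k} (hx : x ∈ regionOf Pv Ps Qv Qs Rv Rs r j)
    (hz : HiggsLattice.blockOf z ∈ Pv) : r ≤ (HiggsLattice.Site.tdist x z : ℝ) :=
  sep_bad hr j hx (Finset.mem_coe.mpr (mem_badSites_of_blockOf_mem_v Pv Ps Qv Qs Rv Rs hz))

/-- p. 558 for the blocks of `P_s`. [cite: Balaban1982Higgs2, (2.7) p.558] -/
theorem block_far_of_mem_Ps (hr : 0 ≤ r) (j : ℕ) {x z : HiggsLattice.Site P k} (hx : x ∈ regionOf Pv Ps Qv Qs Rv Rs r j)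
    (hz : HiggsLattice.blockOf z ∈ Ps) : r ≤ (HiggsLattice.Site.tdist x z : ℝ) :=
  sep_bad hr j hx (Finset.mem_coe.mpr (mem_badSites_of_blockOf_mem_s Pv Ps Qv Qs Rv Rs hz))

/-- p. 558 for the bonds of `Q_v`: both endpoints of a large-field bond are at distance `≥ r` from every point of every `Λ_j`.
[cite: Balaban1982Higgs2, (2.7) p.558] -/
theorem bond_far_of_mem_Qv (hr : 0 ≤ r) (j : ℕ) {x : HiggsLattice.Site P k} {b : HiggsLattice.PBond P k} (hx : x ∈ regionOf Pv Ps Qv Qs Rv Rs r j)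
    (hb : b ∈ Qv) : r ≤ (HiggsLattice.Site.tdist x b.src : ℝ) ∧ r ≤ (HiggsLattice.Site.tdist x b.tgt : ℝ) :=
  ⟨sep_bad hr j hx (Finset.mem_coe.mpr (src_mem_badSites_v Pv Ps Qv Qs Rv Rs hb)),
    sep_bad hr j hx (Finset.mem_coe.mpr (tgt_mem_badSites_v Pv Ps Qv Qs Rv Rs hb))⟩

/-- p. 558 for the bonds of `Q_s`. [cite: Balaban1982Higgs2, (2.7) p.558] -/
theorem bond_far_of_mem_Qs (hr : 0 ≤ r) (j : ℕ) {x : HiggsLattice.Site P k} {b : HiggsLattice.PBond P k} (hx : x ∈ regionOf Pv Ps Qv Qs Rv Rs r j)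
    (hb : b ∈ Qs) : r ≤ (HiggsLattice.Site.tdist x b.src : ℝ) ∧ r ≤ (HiggsLattice.Site.tdist x b.tgt : ℝ) :=
  ⟨sep_bad hr j hx (Finset.mem_coe.mpr (src_mem_badSites_s Pv Ps Qv Qs Rv Rs hb)),
    sep_bad hr j hx (Finset.mem_coe.mpr (tgt_mem_badSites_s Pv Ps Qv Qs Rv Rs hb))⟩

/-- p. 558 for the points of `R_v`. [cite: Balaban1982Higgs2, (2.7) p.558] -/
theorem site_far_of_mem_Rv (hr : 0 ≤ r) (j : ℕ) {x z : HiggsLattice.Site P k} (hx : x ∈ regionOf Pv Ps Qv Qs Rv Rs r j)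
    (hz : z ∈ Rv) : r ≤ (HiggsLattice.Site.tdist x z : ℝ) :=
  sep_bad hr j hx (Finset.mem_coe.mpr (mem_badSites_of_mem_v Pv Ps Qv Qs Rv Rs hz))

/-- p. 558 for the points of `R_s`. [cite: Balaban1982Higgs2, (2.7) p.558] -/
theorem site_far_of_mem_Rs (hr : 0 ≤ r) (j : ℕ) {x z : HiggsLattice.Site P k} (hx : x ∈ regionOf Pv Ps Qv Qs Rv Rs r j)
    (hz : z ∈ Rs) : r ≤ (HiggsLattice.Site.tdist x z : ℝ) :=
  sep_bad hr j hx (Finset.mem_coe.mpr (mem_badSites_of_mem_s Pv Ps Qv Qs Rv Rs hz))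

/-- The regions of the printed data are unions of large blocks, nested, and separated: the three facts together, for
reference by name. [cite: Balaban1982Higgs2, (2.7)–(2.8) p.558] -/
theorem regionOf_spec (hr : 0 ≤ r) (i : ℕ) :
    IsUnionOfLargeBlocks (regionOf Pv Ps Qv Qs Rv Rs r i) ∧
      regionOf Pv Ps Qv Qs Rv Rs r (i + 1) ⊆ regionOf Pv Ps Qv Qs Rv Rs r i ∧
      ∀ x ∈ regionOf Pv Ps Qv Qs Rv Rs r (i + 1), ∀ y ∉ regionOf Pv Ps Qv Qs Rv Rs r i, r < (HiggsLattice.Site.tdist x y : ℝ) :=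
  ⟨region_isUnionOfLargeBlocks _ r i, region_succ_subset hr i, fun _ hx _ hy => sep_region_succ hr i hx hy⟩

end BadSites

/-! ## §6 (v1.1) How far the complements reach: large-block diameter and the thickness of `Λ_iᶜ`

(2.7)–(2.8) read in the other direction: a point of `Λ₀ᶜ` is within distance `< r + (LM − 1)` of a large-field point, a
point of `Λ_{i+1}ᶜ` within `≤ r + 2(LM − 1)` of a point of `Λ_iᶜ`, hence every point of `Λ_iᶜ` is within
`(i + 1)·r + (2i + 1)·(LM − 1)` of the large-field set — the geometric content of *"Λ_{i+1}ᶜ is the sum of all large blocks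
of T₁ with distances from the set Λ_iᶜ less or equal r(ε)"* used when the volumes `|Λ_iᶜ|`, `|Λ_i ∖ Λ_{i+1}|` are counted
against the large-field set ((2.13), (3.46)).  `LM − 1` = the diameter of a large block in the distance (1.3). -/

section Thickness

open B1Ineq234LevelZero (tdist_triangle_real)

/-- Naturals with the same quotient by `n > 0` differ by at most `n − 1`. [folklore] -/
private theorem sub_le_of_div_eq' {a b n : ℕ} (hn : 0 < n) (h : a / n = b / n) : a - b ≤ n - 1 := by
  have h1 : a < a / n * n + n := Nat.lt_div_mul_add hn
  have h2 : b / n * n ≤ b := Nat.div_mul_le_self b n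
  rw [h] at h1
  omega

/-- **A large block of `T^{(k)}` has diameter `≤ LM − 1` in the distance (1.3)** (lattice units; the large blocks are the
blocks with `L` replaced by `ML`, p. 607). [cite: Balaban1982Higgs1, (1.17) p.606] -/
theorem tdist_le_of_largeBlockOf_eq {x y : HiggsLattice.Site P k} (h : largeBlockOf x = largeBlockOf y) :
    HiggsLattice.Site.tdist x y ≤ P.L * P.M - 1 := by
  have hLM : 0 < P.L * P.M := Nat.mul_pos P.hL P.hM
  unfold HiggsLattice.Site.tdist
  refine Finset.sup_le fun μ _ => ?_
  have hq : (x μ).val / (P.L * P.M) = (y μ).val / (P.L * P.M) := by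
    rw [← largeBlockOf_val, ← largeBlockOf_val, h]
  by_cases hle : (y μ).val ≤ (x μ).val
  · calc min (x μ - y μ).val (y μ - x μ).val ≤ (x μ - y μ).val := min_le_left _ _
      _ = (x μ).val - (y μ).val := ZMod.val_sub hle
      _ ≤ P.L * P.M - 1 := sub_le_of_div_eq' hLM hq
  · have hle' : (x μ).val ≤ (y μ).val := (not_le.mp hle).le
    calc min (x μ - y μ).val (y μ - x μ).val ≤ (y μ - x μ).val := min_le_right _ _
      _ = (y μ).val - (x μ).val := ZMod.val_sub hle'
      _ ≤ P.L * P.M - 1 := sub_le_of_div_eq' hLM hq.symm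

/-- The same in real form: `|x − y| ≤ LM − 1` for two sites of one large block. [cite: Balaban1982Higgs1, (1.17) p.606] -/
theorem tdist_le_of_largeBlockOf_eq_real {x y : HiggsLattice.Site P k} (h : largeBlockOf x = largeBlockOf y) :
    (HiggsLattice.Site.tdist x y : ℝ) ≤ (P.L : ℝ) * P.M - 1 := by
  have h1 := tdist_le_of_largeBlockOf_eq h
  have hLM : 1 ≤ P.L * P.M := Nat.mul_pos P.hL P.hM
  have : ((P.L * P.M - 1 : ℕ) : ℝ) = (P.L : ℝ) * P.M - 1 := by rw [Nat.cast_sub hLM, Nat.cast_mul, Nat.cast_one]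
  rw [← this]
  exact_mod_cast h1

/-- The distance from the large block of `x` to `z` is attained: some `x′` of the block has `|x′ − z| = dist`.
[cite: Balaban1982Higgs2, (2.7) p.558] -/
theorem exists_lbDist_eq (x z : HiggsLattice.Site P k) :
    ∃ x' : HiggsLattice.Site P k, largeBlockOf x' = largeBlockOf x ∧ (HiggsLattice.Site.tdist x' z : ℝ) = lbDist x z := by
  obtain ⟨x', hx', h⟩ := Finset.exists_mem_eq_inf' ⟨x, mem_largeBlock_self x⟩ (fun w => (HiggsLattice.Site.tdist w z : ℝ))
  exact ⟨x', mem_largeBlock.mp hx', by rw [lbDist, h]⟩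

/-- The distance between the large blocks of `x` and `y` is attained by a pair of their points. [cite: Balaban1982Higgs2, (2.8) p.558] -/
theorem exists_lbDist₂_eq (x y : HiggsLattice.Site P k) :
    ∃ x' y' : HiggsLattice.Site P k, largeBlockOf x' = largeBlockOf x ∧ largeBlockOf y' = largeBlockOf y ∧
      (HiggsLattice.Site.tdist x' y' : ℝ) = lbDist₂ x y := by
  obtain ⟨p, hp, h⟩ := Finset.exists_mem_eq_inf'
    ⟨(x, y), Finset.mk_mem_product (mem_largeBlock_self x) (mem_largeBlock_self y)⟩
    (fun q : HiggsLattice.Site P k × HiggsLattice.Site P k => (HiggsLattice.Site.tdist q.1 q.2 : ℝ))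
  rw [Finset.mem_product] at hp
  exact ⟨p.1, p.2, mem_largeBlock.mp hp.1, mem_largeBlock.mp hp.2, by rw [lbDist₂, h]⟩

/-- `|x − z| ≤ dist(large block of x, z) + (LM − 1)`. [cite: Balaban1982Higgs2, (2.7) p.558] -/
theorem tdist_le_lbDist_add (x z : HiggsLattice.Site P k) :
    (HiggsLattice.Site.tdist x z : ℝ) ≤ lbDist x z + ((P.L : ℝ) * P.M - 1) := by
  obtain ⟨x', hx', h⟩ := exists_lbDist_eq x z
  calc (HiggsLattice.Site.tdist x z : ℝ) ≤ (HiggsLattice.Site.tdist x x' : ℝ) + (HiggsLattice.Site.tdist x' z : ℝ) :=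
        tdist_triangle_real x x' z
    _ ≤ ((P.L : ℝ) * P.M - 1) + lbDist x z := add_le_add (tdist_le_of_largeBlockOf_eq_real hx'.symm) h.le
    _ = lbDist x z + ((P.L : ℝ) * P.M - 1) := add_comm _ _

/-- `|x − y| ≤ dist(large blocks of x, y) + 2(LM − 1)`. [cite: Balaban1982Higgs2, (2.8) p.558] -/
theorem tdist_le_lbDist₂_add (x y : HiggsLattice.Site P k) :
    (HiggsLattice.Site.tdist x y : ℝ) ≤ lbDist₂ x y + 2 * ((P.L : ℝ) * P.M - 1) := by
  obtain ⟨x', y', hx', hy', h⟩ := exists_lbDist₂_eq x y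
  calc (HiggsLattice.Site.tdist x y : ℝ)
      ≤ (HiggsLattice.Site.tdist x x' : ℝ) + (HiggsLattice.Site.tdist x' y : ℝ) := tdist_triangle_real x x' y
    _ ≤ (HiggsLattice.Site.tdist x x' : ℝ) + ((HiggsLattice.Site.tdist x' y' : ℝ) + (HiggsLattice.Site.tdist y' y : ℝ)) :=
        add_le_add le_rfl (tdist_triangle_real x' y' y)
    _ ≤ ((P.L : ℝ) * P.M - 1) + (lbDist₂ x y + ((P.L : ℝ) * P.M - 1)) :=
        add_le_add (tdist_le_of_largeBlockOf_eq_real hx'.symm)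
          (add_le_add h.le (tdist_le_of_largeBlockOf_eq_real hy'))
    _ = lbDist₂ x y + 2 * ((P.L : ℝ) * P.M - 1) := by ring

variable {bad : Set (HiggsLattice.Site P k)} {r : ℝ}

/-- **(2.7) read outward**: every point of `Λ₀ᶜ` is within distance `< r + (LM − 1)` of a large-field point.
[cite: Balaban1982Higgs2, (2.7) p.558] -/
theorem exists_bad_near_of_mem_regionCompl_zero {x : HiggsLattice.Site P k} (hx : x ∈ regionCompl bad r 0) :
    ∃ z ∈ bad, (HiggsLattice.Site.tdist x z : ℝ) < r + ((P.L : ℝ) * P.M - 1) := by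
  obtain ⟨z, hz, hd⟩ := mem_regionCompl_zero.mp hx
  exact ⟨z, hz, (tdist_le_lbDist_add x z).trans_lt (by linarith)⟩

/-- **(2.8) read outward**: every point of `Λ_{i+1}ᶜ` is within distance `≤ r + 2(LM − 1)` of a point of `Λ_iᶜ`.
[cite: Balaban1982Higgs2, (2.8) p.558] -/
theorem exists_near_of_mem_regionCompl_succ {i : ℕ} {x : HiggsLattice.Site P k} (hx : x ∈ regionCompl bad r (i + 1)) :
    ∃ y ∈ regionCompl bad r i, (HiggsLattice.Site.tdist x y : ℝ) ≤ r + 2 * ((P.L : ℝ) * P.M - 1) := by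
  obtain ⟨y, hy, hd⟩ := mem_regionCompl_succ.mp hx
  exact ⟨y, hy, (tdist_le_lbDist₂_add x y).trans (by linarith)⟩

/-- **The thickness of `Λ_iᶜ`**: every point of `Λ_iᶜ` is within distance `< (i + 1)·r + (2i + 1)·(LM − 1)` of a
large-field point (induction on (2.8) with the triangle inequality for (1.3)). [cite: Balaban1982Higgs2, (2.8) p.558] -/
theorem exists_bad_near_of_mem_regionCompl :
    ∀ (i : ℕ) {x : HiggsLattice.Site P k}, x ∈ regionCompl bad r i →
      ∃ z ∈ bad, (HiggsLattice.Site.tdist x z : ℝ) < ((i : ℝ) + 1) * r + (2 * (i : ℝ) + 1) * ((P.L : ℝ) * P.M - 1)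
  | 0, x, hx => by
      obtain ⟨z, hz, hd⟩ := exists_bad_near_of_mem_regionCompl_zero hx
      exact ⟨z, hz, by simpa using hd⟩
  | i + 1, x, hx => by
      obtain ⟨y, hy, hxy⟩ := exists_near_of_mem_regionCompl_succ hx
      obtain ⟨z, hz, hyz⟩ := exists_bad_near_of_mem_regionCompl i hy
      refine ⟨z, hz, ?_⟩
      calc (HiggsLattice.Site.tdist x z : ℝ) ≤ (HiggsLattice.Site.tdist x y : ℝ) + (HiggsLattice.Site.tdist y z : ℝ) :=
            tdist_triangle_real x y z
        _ < (r + 2 * ((P.L : ℝ) * P.M - 1)) + (((i : ℝ) + 1) * r + (2 * (i : ℝ) + 1) * ((P.L : ℝ) * P.M - 1)) :=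
            add_lt_add_of_le_of_lt hxy hyz
        _ = (((i + 1 : ℕ) : ℝ) + 1) * r + (2 * ((i + 1 : ℕ) : ℝ) + 1) * ((P.L : ℝ) * P.M - 1) := by
            push_cast; ring

/-- The same for the `Finset` `Λ_i`: a point outside `Λ_i` is within `< (i + 1)·r + (2i + 1)·(LM − 1)` of the large fields.
[cite: Balaban1982Higgs2, (2.8) p.558] -/
theorem exists_bad_near_of_not_mem_region (i : ℕ) {x : HiggsLattice.Site P k} (hx : x ∉ region bad r i) :
    ∃ z ∈ bad, (HiggsLattice.Site.tdist x z : ℝ) < ((i : ℝ) + 1) * r + (2 * (i : ℝ) + 1) * ((P.L : ℝ) * P.M - 1) :=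
  exists_bad_near_of_mem_regionCompl i (not_mem_region.mp hx)

/-- In particular, with NO large fields within distance `(i + 1)·r + (2i + 1)·(LM − 1)` of `x`, the point `x` belongs to `Λ_i`.
[cite: Balaban1982Higgs2, (2.8) p.558] -/
theorem mem_region_of_far_from_bad (i : ℕ) {x : HiggsLattice.Site P k}
    (h : ∀ z ∈ bad, ((i : ℝ) + 1) * r + (2 * (i : ℝ) + 1) * ((P.L : ℝ) * P.M - 1) ≤ (HiggsLattice.Site.tdist x z : ℝ)) :
    x ∈ region bad r i := by
  by_contra hx
  obtain ⟨z, hz, hd⟩ := exists_bad_near_of_not_mem_region i hx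
  exact absurd (h z hz) (not_le.mpr hd)

end Thickness

/-! ## §7 (v1.2) The first «admissibility» condition of p. 566 holds for the construction

p. 566, verbatim: *"Here the word “admissible” means that the sets Λ₀^{(j)} have to satisfy all the conditions resulting
from the construction. The sets are unions of big blocks, the set Λ₀^{(0)c} is either empty or has at least one point
whose distance from Λ₀^{(0)} is bigger than r(ε)."*  For the regions CONSTRUCTED in §3 this is a theorem: `Λ₀` is a union
of large blocks (`region_isUnionOfLargeBlocks`), and `Λ₀ᶜ` is empty exactly when there is no large-field point; otherwise a
large-field point lies in `Λ₀ᶜ` at distance `≥ r` from every point of `Λ₀` (what (2.7) with its strict *"less than r(ε)"*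
delivers is the non-strict `≥ r(ε)`; the print's *"bigger than"* is this up to the boundary case `= r(ε)`). -/

section Admissible

variable {bad : Set (HiggsLattice.Site P k)} {r : ℝ}

/-- With at least one large-field point and `r > 0`, `Λ₀ᶜ` is non-empty (it contains that point). [cite: Balaban1982Higgs2, (2.43) p.566] -/
theorem compl_region_zero_nonempty (hr : 0 < r) {z : HiggsLattice.Site P k} (hz : z ∈ bad) :
    ((region bad r 0)ᶜ).Nonempty :=
  ⟨z, Finset.mem_compl.mpr (not_mem_region_of_bad hr 0 hz)⟩

/-- Conversely, with NO large-field point `Λ_iᶜ` is empty. [cite: Balaban1982Higgs2, (2.43) p.566] -/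
theorem compl_region_eq_empty_of_forall_not_bad (h : ∀ z : HiggsLattice.Site P k, z ∉ bad) (i : ℕ) :
    (region bad r i)ᶜ = ∅ := by
  have hb : bad = ∅ := Set.eq_empty_iff_forall_notMem.mpr h
  subst hb
  rw [region_eq_univ_of_bad_empty r i, Finset.compl_univ]

/-- **p. 566, the level-`0` admissibility condition, PROVED for the construction (2.7)**: `Λ₀ᶜ` is either empty or contains
a point (a large-field point) whose distance from every point of `Λ₀` is `≥ r` (`r > 0`). [cite: Balaban1982Higgs2, (2.43) p.566] -/
theorem admissible_zero (hr : 0 < r) :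
    (region bad r 0)ᶜ = ∅ ∨
      ∃ z ∈ (region bad r 0)ᶜ, ∀ x ∈ region bad r 0, r ≤ (HiggsLattice.Site.tdist z x : ℝ) := by
  by_cases h : ∃ z : HiggsLattice.Site P k, z ∈ bad
  · obtain ⟨z, hz⟩ := h
    exact Or.inr ⟨z, Finset.mem_compl.mpr (not_mem_region_of_bad hr 0 hz), fun x hx => sep_bad' hr.le 0 hx hz⟩
  · exact Or.inl (compl_region_eq_empty_of_forall_not_bad (fun z hz => h ⟨z, hz⟩) 0)

/-- The same with the distance read as `dist(z, Λ₀) = min_{x ∈ Λ₀} |z − x|` (r14's `distC` applied to `Λ₀ᶜ`: `distC Λ₀ᶜ z` is the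
distance from `z` to `(Λ₀ᶜ)ᶜ = Λ₀`): `Λ₀ᶜ = ∅`, or `Λ₀ = ∅` (then the distance is not defined — `distC` returns `0`), or some
`z ∈ Λ₀ᶜ` has `dist(z, Λ₀) ≥ r`. [cite: Balaban1982Higgs2, (2.43) p.566] -/
theorem admissible_zero_distC (hr : 0 < r) :
    (region bad r 0)ᶜ = ∅ ∨ region bad r 0 = ∅ ∨ ∃ z ∈ (region bad r 0)ᶜ, r ≤ distC (region bad r 0)ᶜ z := by
  rcases admissible_zero (bad := bad) hr with h | ⟨z, hz, hfar⟩
  · exact Or.inl h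
  · by_cases hne : (region bad r 0).Nonempty
    · refine Or.inr (Or.inr ⟨z, hz, ?_⟩)
      have hne' : ((region bad r 0)ᶜᶜ).Nonempty := by rwa [compl_compl]
      unfold distC
      rw [dif_pos hne', Finset.le_inf'_iff]
      intro x hx
      rw [compl_compl] at hx
      exact hfar x hx
    · exact Or.inr (Or.inl (Finset.not_nonempty_iff_eq_empty.mp hne))

end Admissible

/-! ## §8 (v1.3) Volumes: balls of the distance (1.3) and `|Λ_iᶜ| ≤ |large-field set| · (2ρ_i + 1)^d`

p. 592–593, verbatim: *"It is so because a distance of each large block contained in Λ₀^{(0)c} from the set P_v^{(0)} ∪ … ∪ R_s^{(0)}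
is ≦ r(ε). Thus we have |𝒞₀| ≦ 3^d(|P_v^{(0)}| + … + |R_s^{(0)}|). (3.44) … Λ₀^{(0)c} ⊂ ⋃_{□∈𝒟₀} □ and
|Λ₀^{(0)c}| ≦ (2r(ε))^d|𝒞₀|. (3.48)"* — the volume of the complement is controlled by the NUMBER of large-field elements
times the volume of a cube of side `O(r(ε))`.  On the concrete torus, without the intermediate cube families `𝒞₀`/`𝒟₀`:
`Λ_iᶜ ⊂ ⋃_{z bad} Ball(z, ρ_i)`, `ρ_i = ⌊(i+1)r + (2i+1)(LM − 1)⌋`, and a ball of radius `n` of (1.3) has at most `(2n + 1)^d`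
points, whence `|Λ_iᶜ| ≤ |bad| · (2ρ_i + 1)^d`. -/

section Volume

/-- On `ZMod N`: if `min((a − b).val, (b − a).val) ≤ n` then `b = a + t` for an integer `t ∈ [−n, n]` (the per-coordinate
content of a ball of the torus distance (1.3)). [cite: Balaban1982Higgs1, (1.3) p.604] -/
theorem exists_int_of_min_val_le {N : ℕ} [NeZero N] (a b : ZMod N) {n : ℕ} (h : min (a - b).val (b - a).val ≤ n) :
    ∃ t ∈ Finset.Icc (-(n : ℤ)) n, b = a + (t : ZMod N) := by
  rcases min_le_iff.mp h with h1 | h2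
  · refine ⟨-((a - b).val : ℤ), Finset.mem_Icc.mpr ⟨by omega, by omega⟩, ?_⟩
    rw [Int.cast_neg, Int.cast_natCast, ZMod.natCast_zmod_val, ← sub_eq_add_neg, sub_sub_cancel]
  · refine ⟨((b - a).val : ℤ), Finset.mem_Icc.mpr ⟨by omega, by omega⟩, ?_⟩
    rw [Int.cast_natCast, ZMod.natCast_zmod_val, add_sub_cancel]

/-- The ball of radius `n` of the distance (1.3) around `z`, as a `Finset` of sites. [cite: Balaban1982Higgs1, (1.3) p.604] -/
def ball (z : HiggsLattice.Site P k) (n : ℕ) : Finset (HiggsLattice.Site P k) :=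
  Finset.univ.filter fun x => HiggsLattice.Site.tdist z x ≤ n

/-- Membership in the ball. [cite: Balaban1982Higgs1, (1.3) p.604] -/
theorem mem_ball {z x : HiggsLattice.Site P k} {n : ℕ} : x ∈ ball z n ↔ HiggsLattice.Site.tdist z x ≤ n := by
  unfold ball
  simp only [Finset.mem_filter, Finset.mem_univ, true_and]

/-- A ball of (1.3) lies in the product of the coordinate «intervals» `{z_μ + t : |t| ≤ n}`. [cite: Balaban1982Higgs1, (1.3) p.604] -/
theorem ball_subset_piFinset (z : HiggsLattice.Site P k) (n : ℕ) :
    ball z n ⊆ Fintype.piFinset fun μ : Fin P.d =>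
      (Finset.Icc (-(n : ℤ)) n).image fun t : ℤ => z μ + (t : ZMod (P.sitesPerDir k μ)) := by
  intro x hx
  rw [mem_ball] at hx
  refine Fintype.mem_piFinset.mpr fun μ => ?_
  have hμ : min (z μ - x μ).val (x μ - z μ).val ≤ n := by
    unfold HiggsLattice.Site.tdist at hx
    exact (Finset.le_sup (f := fun ν : Fin P.d => min (z ν - x ν).val (x ν - z ν).val) (Finset.mem_univ μ)).trans hx
  obtain ⟨t, ht, hxt⟩ := exists_int_of_min_val_le (z μ) (x μ) hμ
  exact Finset.mem_image.mpr ⟨t, ht, hxt.symm⟩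

/-- **A ball of radius `n` of the torus distance (1.3) has at most `(2n + 1)^d` points.** [cite: Balaban1982Higgs1, (1.3) p.604] -/
theorem card_ball_le (z : HiggsLattice.Site P k) (n : ℕ) : (ball z n).card ≤ (2 * n + 1) ^ P.d := by
  refine (Finset.card_le_card (ball_subset_piFinset z n)).trans ?_
  refine (Fintype.card_piFinset _).trans_le ?_
  calc ∏ μ : Fin P.d, ((Finset.Icc (-(n : ℤ)) n).image fun t : ℤ => z μ + (t : ZMod (P.sitesPerDir k μ))).card
      ≤ ∏ _μ : Fin P.d, (2 * n + 1) := by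
        refine Finset.prod_le_prod' fun μ _ => Finset.card_image_le.trans ?_
        rw [Int.card_Icc]
        omega
    _ = (2 * n + 1) ^ P.d := by rw [Finset.prod_const, Finset.card_univ, Fintype.card_fin]

variable {r : ℝ}

/-- A real strict bound on the (integer-valued) distance gives membership in the ball of radius `⌊ρ⌋`. [cite: Balaban1982Higgs1, (1.3) p.604] -/
theorem mem_ball_of_tdist_lt {z x : HiggsLattice.Site P k} {ρ : ℝ} (h : (HiggsLattice.Site.tdist x z : ℝ) < ρ) :
    x ∈ ball z ⌊ρ⌋₊ := by
  rw [mem_ball, tdist_comm]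
  exact Nat.le_floor h.le

/-- **`Λ_iᶜ` lies in the union of the balls of radius `ρ_i = ⌊(i+1)r + (2i+1)(LM − 1)⌋` around the large-field points** (§6
thickness). [cite: Balaban1982Higgs2, (3.48) p.593] -/
theorem compl_region_subset_biUnion_ball (badF : Finset (HiggsLattice.Site P k)) (r : ℝ) (i : ℕ) :
    (region (↑badF : Set (HiggsLattice.Site P k)) r i)ᶜ ⊆
      badF.biUnion fun z => ball z ⌊((i : ℝ) + 1) * r + (2 * (i : ℝ) + 1) * ((P.L : ℝ) * P.M - 1)⌋₊ := by
  intro x hx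
  obtain ⟨z, hz, hd⟩ := exists_bad_near_of_not_mem_region i (Finset.mem_compl.mp hx)
  exact Finset.mem_biUnion.mpr ⟨z, Finset.mem_coe.mp hz, mem_ball_of_tdist_lt hd⟩

/-- **The volume of `Λ_iᶜ`**: `|Λ_iᶜ| ≤ |large-field set| · (2ρ_i + 1)^d`, `ρ_i = ⌊(i+1)r + (2i+1)(LM − 1)⌋` — the concrete
form of (3.44) + (3.48)/(3.50) (the complement's volume is the number of large-field elements times the volume of a cube of
side `O(r)`), for the regions CONSTRUCTED in §3 from any finite large-field set. [cite: Balaban1982Higgs2, (3.48) p.593] -/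
theorem card_compl_region_le (badF : Finset (HiggsLattice.Site P k)) (r : ℝ) (i : ℕ) :
    ((region (↑badF : Set (HiggsLattice.Site P k)) r i)ᶜ).card ≤
      badF.card * (2 * ⌊((i : ℝ) + 1) * r + (2 * (i : ℝ) + 1) * ((P.L : ℝ) * P.M - 1)⌋₊ + 1) ^ P.d := by
  refine (Finset.card_le_card (compl_region_subset_biUnion_ball badF r i)).trans ?_
  refine Finset.card_biUnion_le.trans ?_
  calc ∑ z ∈ badF, (ball z ⌊((i : ℝ) + 1) * r + (2 * (i : ℝ) + 1) * ((P.L : ℝ) * P.M - 1)⌋₊).card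
      ≤ ∑ _z ∈ badF, (2 * ⌊((i : ℝ) + 1) * r + (2 * (i : ℝ) + 1) * ((P.L : ℝ) * P.M - 1)⌋₊ + 1) ^ P.d :=
        Finset.sum_le_sum fun z _ => card_ball_le z _
    _ = badF.card * (2 * ⌊((i : ℝ) + 1) * r + (2 * (i : ℝ) + 1) * ((P.L : ℝ) * P.M - 1)⌋₊ + 1) ^ P.d := by
        rw [Finset.sum_const, smul_eq_mul]

/-- The first step (`i = 0`): `|Λ₀ᶜ| ≤ |large-field set| · (2⌊r + (LM − 1)⌋ + 1)^d` — cf. (3.48) `|Λ₀^{(0)c}| ≦ (2r(ε))^d|𝒞₀|` with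
(3.44) `|𝒞₀| ≦ 3^d(|P_v^{(0)}| + … + |R_s^{(0)}|)`. [cite: Balaban1982Higgs2, (3.48) p.593] -/
theorem card_compl_region_zero_le (badF : Finset (HiggsLattice.Site P k)) (r : ℝ) :
    ((region (↑badF : Set (HiggsLattice.Site P k)) r 0)ᶜ).card ≤
      badF.card * (2 * ⌊r + ((P.L : ℝ) * P.M - 1)⌋₊ + 1) ^ P.d := by
  have h := card_compl_region_le badF r 0
  simpa using h

end Volume

end Literature.MathematicalPhysics.QuantumFieldTheory.Balaban1983to89.B2Eq28RegionsConcrete
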